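import Mathlib.Analysis.Complex.TaylorSeries
import Mathlib.Analysis.Calculus.SmoothSeries
import Mathlib.Analysis.SpecialFunctions.Exponential
import Mathlib.Analysis.Complex.Convex
import Mathlib.NumberTheory.LSeries.Convergence
import Literature.NumberTheory.LFunctions.LandauOscillation
import Literature.Analysis.Complex.LogDerivZeros
import HarnessLib

/-!
# Landau's theorem for generalized Dirichlet series with non-negative coefficients

Topic: `Literature/NumberTheory/LFunctions`. Montgomery–Vaughan, *Multiplicative Number Theory I*,
§1.2, Theorem 1.7 (Landau 1905): if `α(s) = ∑ aₙ n^{-s}` has `aₙ ≥ 0` and finite abscissa of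
convergence `σ_c`, then the point `σ_c` is a singularity of `α(s)`; and (MV, notes to §1.2)
"Landau's proof extends to generalized Dirichlet series" `∑ aᵢ e^{-λᵢ s}`. This is the series
companion of `Literature/NumberTheory/LFunctions/LandauOscillation.lean` (the Mellin-integral form,
MV Lemma 15.1), imported for its half-plane lemma `isOpen_re_gt` and followed in architecture, and of
`Literature/NumberTheory/LFunctions/LandauDirichletSeries.lean` (the ordinary form over Mathlib's
`LSeries.abscissaOfAbsConv`); it is the "lemma of Landau" invoked by Jacquet–Shalika,
*Amer. J. Math.* 103 (1981), proof of Thm. (5.3), for the series `∑_v ∑_k |tr A_v^k|²/(k q_v^{ks})`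
(a generalized Dirichlet series indexed by prime powers of a number field), which is why the index
set `ι` is arbitrary here (an ordinary Dirichlet series would first require regrouping by the value
of `q_v^k`).

We formalise the theorem in the (contrapositive, quantitative) form in which it is *used*: for a
generalized Dirichlet series `F(s) = ∑ᵢ aᵢ e^{-λᵢ s}` with `aᵢ ≥ 0`, `λᵢ ≥ 0`, absolutely convergent
at some real `σ₁`,

* **disc form** (`Landau.summable_of_differentiableOn_ball`, MV proof of Thm. 1.7 verbatim): if `F`
  agrees near a real point `σ₂ > σ₁` with a function holomorphic on the disc `|s − σ₂| < R`, then
  the series converges at every real `σ > σ₂ − R`;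
* **abscissa form** (`Landau.summable_of_differentiableOn_union_convex`): if `F` agrees on
  `Re s > σ₁` with a function holomorphic on `{Re s > σ₁} ∪ W₀`, `W₀` a convex open set containing
  the real segment `(a, σ₁ + 1]`, then the series converges at every real `σ > a` (so no real point
  `> a` is the abscissa: the abscissa is a singularity);
* **half-plane form** (`Landau.summable_of_differentiableOn_halfPlane`, the case
  `W₀ = {Re s > a}`): holomorphic continuation to an open right half-plane forces convergence on that
  half-plane — the form used by Jacquet–Shalika loc. cit. and in non-vanishing arguments;
* the bridge to Mathlib's ordinary Dirichlet series (`Landau.LSeries_eq_genDirichlet`,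
  `Landau.LSeriesSummable_ofReal_iff`: `LSeries f` is the case `λₙ = log n`), the ordinary case of
  Landau's theorem itself being the subject of the sibling file
  `Literature/NumberTheory/LFunctions/LandauDirichletSeries.lean` (over `LSeries.abscissaOfAbsConv`);
* **exponential form** (`Landau.summable_of_differentiableOn_halfPlane_cexp`, folklore; the shape
  needed for logarithms of Euler products, as in Jacquet–Shalika loc. cit. (5.3.3)–(5.3.4), where
  `F = log L_S(s, π × π̃)` has non-negative coefficients but it is `e^{F} = L_S` that is continued):
  if `e^{F}` agrees on `Re s > σ₁` with a function holomorphic on `Re s > A`, then the series `F`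
  converges at every real `σ > A` — no non-vanishing hypothesis is needed, because at a putative
  abscissa `σ_c > A` one has `Re Φ(σ_c) = lim e^{F(σ)} ≥ 1`, so `Φ` has a holomorphic logarithm on
  a disc about `σ_c` (`Landau.exists_differentiableOn_cexp_eq`, a corollary of the tree's
  `Literature.Analysis.Complex.exists_log_on_ball`) which continues `F`, and the disc form applies.

All statements are proved (sorry-free); nothing here is in Mathlib (Mathlib has the positivity half
of the circle of ideas, `LSeries.positive_of_differentiable_of_eqOn`, `Complex.Positivity`, but not
Landau's convergence theorem: grep `Landau`, `abscissa` in `NumberTheory/LSeries`).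

## Proof sketch (MV, proof of Thm. 1.7)

`F` is holomorphic on `Re s > σ₁` with `F^{(k)}(s) = ∑ᵢ aᵢ (−λᵢ)^k e^{−λᵢ s}` (termwise
differentiation, `hasDerivAt_tsum_of_isPreconnected`). The Taylor series of the continuation `Φ` at
`σ₂` converges on the disc (`Complex.hasSum_taylorSeries_on_ball`); at the real point `σ = σ₂ − r`,
`0 < r < R`, it reads `Φ(σ) = ∑_k (r^k/k!) ∑ᵢ aᵢ λᵢ^k e^{−λᵢ σ₂}`, a convergent series of series of
non-negative terms, so the double family is summable (`summable_prod_of_nonneg`) and may be summed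
over `k` first (`HasSum.prod_fiberwise`): `∑ᵢ aᵢ e^{−λᵢ σ₂} e^{r λᵢ} = ∑ᵢ aᵢ e^{−λᵢ σ} < ∞`. The
abscissa form applies the disc form at the infimum `σ_c` of the abscissae of convergence in `[a, σ₁]`,
after the identity theorem on the preconnected open set `{Re s > σ₁} ∪ (W₀ ∩ {Re s > σ_c})`.

## References

* H. L. Montgomery, R. C. Vaughan, *Multiplicative Number Theory I. Classical Theory*, Cambridge
  Studies in Advanced Mathematics 97, CUP 2007: §1.2, Thm. 1.7 and its proof (held PDF pp. 25–26),
  and the notes to §1.2 on generalized Dirichlet series (held PDF pp. 35–36). [MontgomeryVaughan2007]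
* E. Landau, *Über einen Satz von Tschebyschef*, Math. Ann. 61 (1905), 527–550.
* H. Jacquet, J. A. Shalika, *On Euler products and the classification of automorphic
  representations I*, Amer. J. Math. 103 (1981), proof of Thm. (5.3). [JacquetShalikaAJM1981]
-/

noncomputable section

open Complex Filter Topology Set

namespace Literature.NumberTheory.LFunctions

namespace Landau

variable {ι : Type*}

/-! ### Generalized Dirichlet series and their formal derivatives -/

/-- The summand `aᵢ (−λᵢ)^k e^{−λᵢ s}` of the `k`-th derivative of the generalized Dirichlet series
`∑ᵢ aᵢ e^{−λᵢ s}` (`k = 0`: the series itself). [cite: MontgomeryVaughan2007, §1.2 Thm. 1.7] -/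
def dirichletTerm (a ℓ : ι → ℝ) (k : ℕ) (s : ℂ) (i : ι) : ℂ :=
  (a i : ℂ) * ((-(ℓ i : ℂ)) ^ k * Complex.exp (-(ℓ i : ℂ) * s))

/-- `∑ᵢ aᵢ (−λᵢ)^k e^{−λᵢ s}`, the `k`-th `s`-derivative of the generalized Dirichlet series
(`k = 0` is the series itself, `genDirichlet`). [cite: MontgomeryVaughan2007, §1.2 Thm. 1.7] -/
def genDirichletDeriv (a ℓ : ι → ℝ) (k : ℕ) (s : ℂ) : ℂ :=
  ∑' i, dirichletTerm a ℓ k s i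

/-- The **generalized Dirichlet series** `F(s) = ∑ᵢ aᵢ e^{−λᵢ s}` with real coefficients `aᵢ` and
real frequencies `λᵢ` (MV, notes to §1.2: ordinary Dirichlet series are `λₙ = log n`, power series
`λₙ = n`); an unconditional sum (`tprod`/`tsum` convention: junk `0` where not summable).
[cite: MontgomeryVaughan2007, §1.2 (notes, generalized Dirichlet series)] -/
def genDirichlet (a ℓ : ι → ℝ) (s : ℂ) : ℂ :=
  ∑' i, (a i : ℂ) * Complex.exp (-(ℓ i : ℂ) * s)

/-- `genDirichlet` is the case `k = 0` of `genDirichletDeriv`. [folklore] -/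
theorem genDirichletDeriv_zero (a ℓ : ι → ℝ) : genDirichletDeriv a ℓ 0 = genDirichlet a ℓ := by
  funext s
  simp [genDirichletDeriv, genDirichlet, dirichletTerm]

variable {a ℓ : ι → ℝ}

/-- Norm of the summand: `‖aᵢ (−λᵢ)^k e^{−λᵢ s}‖ = |aᵢ| |λᵢ|^k e^{−λᵢ Re s}`. [folklore] -/
theorem norm_dirichletTerm (k : ℕ) (s : ℂ) (i : ι) :
    ‖dirichletTerm a ℓ k s i‖ = |a i| * (|ℓ i| ^ k * Real.exp (-(ℓ i * s.re))) := by
  unfold dirichletTerm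
  rw [norm_mul, norm_mul, norm_pow, norm_neg, Complex.norm_real, Complex.norm_real,
    Real.norm_eq_abs, Real.norm_eq_abs, Complex.norm_exp]
  congr 3
  simp [Complex.mul_re]

/-- At a real point and for `aᵢ, λᵢ ≥ 0` the summand is the real number
`(−1)^k aᵢ λᵢ^k e^{−λᵢ σ}`. [folklore] -/
theorem dirichletTerm_ofReal (k : ℕ) (σ : ℝ) (i : ι) :
    dirichletTerm a ℓ k (σ : ℂ) i =
      (((-1 : ℝ) ^ k * (a i * (ℓ i ^ k * Real.exp (-(ℓ i * σ)))) : ℝ) : ℂ) := by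
  unfold dirichletTerm
  push_cast
  rw [neg_pow]
  ring

/-- `λ^k e^{−λ δ} ≤ k!/δ^k` for `λ ≥ 0`, `δ > 0` (from `(λδ)^k/k! ≤ e^{λδ}`). [folklore] -/
theorem pow_mul_exp_neg_le {x δ : ℝ} (hx : 0 ≤ x) (hδ : 0 < δ) (k : ℕ) :
    x ^ k * Real.exp (-(x * δ)) ≤ k.factorial / δ ^ k := by
  have h1 : (x * δ) ^ k / k.factorial ≤ Real.exp (x * δ) :=
    Real.pow_div_factorial_le_exp (x * δ) (mul_nonneg hx hδ.le) k
  have hk : (0 : ℝ) < k.factorial := by exact_mod_cast k.factorial_pos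
  have hδk : 0 < δ ^ k := pow_pos hδ k
  rw [div_le_iff₀ hk] at h1
  rw [le_div_iff₀ hδk, Real.exp_neg]
  have hexp : 0 < Real.exp (x * δ) := Real.exp_pos _
  calc x ^ k * (Real.exp (x * δ))⁻¹ * δ ^ k = (x * δ) ^ k / Real.exp (x * δ) := by
        rw [mul_pow]; field_simp
    _ ≤ Real.exp (x * δ) * k.factorial / Real.exp (x * δ) := by gcongr
    _ = k.factorial := by field_simp

/-- Domination on a closed half-plane: for `σ₁ < σ' ≤ Re s`, `aᵢ ≥ 0`, `λᵢ ≥ 0`,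
`‖aᵢ (−λᵢ)^k e^{−λᵢ s}‖ ≤ (k!/(σ'−σ₁)^k) · aᵢ e^{−λᵢ σ₁}`. [folklore] -/
theorem norm_dirichletTerm_le (ha : ∀ i, 0 ≤ a i) (hℓ : ∀ i, 0 ≤ ℓ i) {σ₁ σ' : ℝ} (hσ : σ₁ < σ')
    {s : ℂ} (hs : σ' ≤ s.re) (k : ℕ) (i : ι) :
    ‖dirichletTerm a ℓ k s i‖ ≤ (k.factorial / (σ' - σ₁) ^ k) * (a i * Real.exp (-(ℓ i * σ₁))) := by
  rw [norm_dirichletTerm, abs_of_nonneg (ha i), abs_of_nonneg (hℓ i)]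
  have hδ : 0 < σ' - σ₁ := sub_pos.2 hσ
  have h1 : ℓ i ^ k * Real.exp (-(ℓ i * (σ' - σ₁))) ≤ k.factorial / (σ' - σ₁) ^ k :=
    pow_mul_exp_neg_le (hℓ i) hδ k
  have h2 : Real.exp (-(ℓ i * s.re)) ≤ Real.exp (-(ℓ i * σ')) := by
    rw [Real.exp_le_exp]
    have := mul_le_mul_of_nonneg_left hs (hℓ i)
    linarith
  calc a i * (ℓ i ^ k * Real.exp (-(ℓ i * s.re)))
      ≤ a i * (ℓ i ^ k * Real.exp (-(ℓ i * σ'))) :=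
        mul_le_mul_of_nonneg_left (mul_le_mul_of_nonneg_left h2 (pow_nonneg (hℓ i) k)) (ha i)
    _ = a i * ((ℓ i ^ k * Real.exp (-(ℓ i * (σ' - σ₁)))) * Real.exp (-(ℓ i * σ₁))) := by
        rw [mul_assoc, ← Real.exp_add]; congr 3; ring
    _ ≤ a i * ((k.factorial / (σ' - σ₁) ^ k) * Real.exp (-(ℓ i * σ₁))) :=
        mul_le_mul_of_nonneg_left (mul_le_mul_of_nonneg_right h1 (Real.exp_pos _).le) (ha i)
    _ = (k.factorial / (σ' - σ₁) ^ k) * (a i * Real.exp (-(ℓ i * σ₁))) := by ring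

/-- If `∑ᵢ aᵢ e^{−λᵢ σ₁} < ∞` (`aᵢ, λᵢ ≥ 0`), then the series of `k`-th derivative summands
converges absolutely on `Re s > σ₁`. [cite: MontgomeryVaughan2007, §1.2 Thm. 1.7 (proof)] -/
theorem summable_norm_dirichletTerm (ha : ∀ i, 0 ≤ a i) (hℓ : ∀ i, 0 ≤ ℓ i) {σ₁ : ℝ}
    (h₁ : Summable fun i ↦ a i * Real.exp (-(ℓ i * σ₁))) (k : ℕ) {s : ℂ} (hs : σ₁ < s.re) :
    Summable fun i ↦ ‖dirichletTerm a ℓ k s i‖ := by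
  refine (h₁.mul_left (k.factorial / (s.re - σ₁) ^ k)).of_nonneg_of_le
    (fun i ↦ norm_nonneg _) fun i ↦ ?_
  exact norm_dirichletTerm_le ha hℓ hs le_rfl k i

/-- Summability of the `k`-th derivative summands on `Re s > σ₁`. [folklore] -/
theorem summable_dirichletTerm (ha : ∀ i, 0 ≤ a i) (hℓ : ∀ i, 0 ≤ ℓ i) {σ₁ : ℝ}
    (h₁ : Summable fun i ↦ a i * Real.exp (-(ℓ i * σ₁))) (k : ℕ) {s : ℂ} (hs : σ₁ < s.re) :
    Summable (dirichletTerm a ℓ k s) :=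
  (summable_norm_dirichletTerm ha hℓ h₁ k hs).of_norm

/-- Absolute convergence is monotone in `σ`: convergence at `σ₁` gives convergence at every real
`σ ≥ σ₁` (`λᵢ ≥ 0`). [folklore] -/
theorem summable_exp_of_le (ha : ∀ i, 0 ≤ a i) (hℓ : ∀ i, 0 ≤ ℓ i) {σ₁ σ : ℝ} (hσ : σ₁ ≤ σ)
    (h₁ : Summable fun i ↦ a i * Real.exp (-(ℓ i * σ₁))) :
    Summable fun i ↦ a i * Real.exp (-(ℓ i * σ)) := by
  refine h₁.of_nonneg_of_le (fun i ↦ mul_nonneg (ha i) (Real.exp_pos _).le) fun i ↦ ?_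
  refine mul_le_mul_of_nonneg_left ?_ (ha i)
  rw [Real.exp_le_exp]
  have := mul_le_mul_of_nonneg_left hσ (hℓ i)
  linarith

/-- The real series at `σ` is the value of `genDirichlet` at the real point `σ`. [folklore] -/
theorem genDirichlet_ofReal (σ : ℝ) :
    genDirichlet a ℓ (σ : ℂ) = ((∑' i, a i * Real.exp (-(ℓ i * σ)) : ℝ) : ℂ) := by
  unfold genDirichlet
  rw [Complex.ofReal_tsum]
  congr 1
  funext i
  push_cast
  ring_nf

/-- The derivative series at a real point is real:
`genDirichletDeriv a λ k σ = (−1)^k ∑ᵢ aᵢ λᵢ^k e^{−λᵢ σ}`. [folklore] -/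
theorem genDirichletDeriv_ofReal (k : ℕ) (σ : ℝ) :
    genDirichletDeriv a ℓ k (σ : ℂ) =
      (((-1 : ℝ) ^ k * ∑' i, a i * (ℓ i ^ k * Real.exp (-(ℓ i * σ))) : ℝ) : ℂ) := by
  unfold genDirichletDeriv
  rw [← tsum_mul_left, Complex.ofReal_tsum]
  exact tsum_congr fun i ↦ dirichletTerm_ofReal k σ i

/-! ### Holomorphy and termwise differentiation on the half-plane of convergence -/

/-- Derivative of one summand: `d/ds (aᵢ (−λᵢ)^k e^{−λᵢ s}) = aᵢ (−λᵢ)^{k+1} e^{−λᵢ s}`. [folklore] -/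
theorem hasDerivAt_dirichletTerm (k : ℕ) (s : ℂ) (i : ι) :
    HasDerivAt (fun z ↦ dirichletTerm a ℓ k z i) (dirichletTerm a ℓ (k + 1) s i) s := by
  unfold dirichletTerm
  have h1 : HasDerivAt (fun z : ℂ ↦ -(ℓ i : ℂ) * z) (-(ℓ i : ℂ)) s := by
    simpa using (hasDerivAt_id s).const_mul (-(ℓ i : ℂ))
  have h2 : HasDerivAt (fun z : ℂ ↦ Complex.exp (-(ℓ i : ℂ) * z))
      (Complex.exp (-(ℓ i : ℂ) * s) * (-(ℓ i : ℂ))) s := h1.cexp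
  have h3 := (h2.const_mul ((-(ℓ i : ℂ)) ^ k)).const_mul (a i : ℂ)
  refine h3.congr_deriv ?_
  rw [pow_succ]
  ring

/-- **Termwise differentiation** ("the coefficients `c_k` can be calculated by means of (1.8)",
MV p. 16): for `Re s₀ > σ₁`,
`d/ds ∑ᵢ aᵢ (−λᵢ)^k e^{−λᵢ s} = ∑ᵢ aᵢ (−λᵢ)^{k+1} e^{−λᵢ s}` at `s₀`.
[cite: MontgomeryVaughan2007, §1.2 Thm. 1.7 (proof)] -/
theorem hasDerivAt_genDirichletDeriv (ha : ∀ i, 0 ≤ a i) (hℓ : ∀ i, 0 ≤ ℓ i) {σ₁ : ℝ}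
    (h₁ : Summable fun i ↦ a i * Real.exp (-(ℓ i * σ₁))) (k : ℕ) {s₀ : ℂ} (hs₀ : σ₁ < s₀.re) :
    HasDerivAt (genDirichletDeriv a ℓ k) (genDirichletDeriv a ℓ (k + 1) s₀) s₀ := by
  set σ' : ℝ := (σ₁ + s₀.re) / 2 with hσ'
  have hσ'1 : σ₁ < σ' := by rw [hσ']; linarith
  have hσ's : σ' < s₀.re := by rw [hσ']; linarith
  set t : Set ℂ := {s : ℂ | σ' < s.re} with ht
  have hto : IsOpen t := isOpen_re_gt σ'
  have htc : IsPreconnected t := (convex_halfSpace_re_gt σ').isPreconnected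
  have hs₀t : s₀ ∈ t := hσ's
  set u : ι → ℝ := fun i ↦ ((k + 1).factorial / (σ' - σ₁) ^ (k + 1)) *
    (a i * Real.exp (-(ℓ i * σ₁))) with hu
  have hus : Summable u := h₁.mul_left _
  have key := hasDerivAt_tsum_of_isPreconnected (g := fun i z ↦ dirichletTerm a ℓ k z i)
    (g' := fun i z ↦ dirichletTerm a ℓ (k + 1) z i) hus hto htc
    (fun i y _ ↦ hasDerivAt_dirichletTerm k y i)
    (fun i y hy ↦ norm_dirichletTerm_le ha hℓ hσ'1 (le_of_lt hy) (k + 1) i) hs₀t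
    (summable_dirichletTerm ha hℓ h₁ k hs₀) hs₀t
  exact key

/-- The derivative series are holomorphic on `Re s > σ₁`. [cite: MontgomeryVaughan2007, §1.2 Thm. 1.7 (proof)] -/
theorem differentiableOn_genDirichletDeriv (ha : ∀ i, 0 ≤ a i) (hℓ : ∀ i, 0 ≤ ℓ i) {σ₁ : ℝ}
    (h₁ : Summable fun i ↦ a i * Real.exp (-(ℓ i * σ₁))) (k : ℕ) :
    DifferentiableOn ℂ (genDirichletDeriv a ℓ k) {s : ℂ | σ₁ < s.re} :=
  fun _ hs ↦ (hasDerivAt_genDirichletDeriv ha hℓ h₁ k hs).differentiableAt.differentiableWithinAt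

/-- **MV Thm. 1.1/1.7, first half**: `F(s) = ∑ᵢ aᵢ e^{−λᵢ s}` is holomorphic on the half-plane
`Re s > σ₁` of absolute convergence. [cite: MontgomeryVaughan2007, §1.2 Thm. 1.7 (proof)] -/
theorem differentiableOn_genDirichlet (ha : ∀ i, 0 ≤ a i) (hℓ : ∀ i, 0 ≤ ℓ i) {σ₁ : ℝ}
    (h₁ : Summable fun i ↦ a i * Real.exp (-(ℓ i * σ₁))) :
    DifferentiableOn ℂ (genDirichlet a ℓ) {s : ℂ | σ₁ < s.re} := by
  rw [← genDirichletDeriv_zero]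
  exact differentiableOn_genDirichletDeriv ha hℓ h₁ 0

/-- Iterated derivatives: `(d/ds)^j ∑ᵢ aᵢ (−λᵢ)^k e^{−λᵢ s} = ∑ᵢ aᵢ (−λᵢ)^{k+j} e^{−λᵢ s}` on
`Re s > σ₁`. [cite: MontgomeryVaughan2007, §1.2 Thm. 1.7 (proof), (1.8)] -/
theorem iteratedDeriv_genDirichletDeriv (ha : ∀ i, 0 ≤ a i) (hℓ : ∀ i, 0 ≤ ℓ i) {σ₁ : ℝ}
    (h₁ : Summable fun i ↦ a i * Real.exp (-(ℓ i * σ₁))) (j k : ℕ) {s : ℂ} (hs : σ₁ < s.re) :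
    iteratedDeriv j (genDirichletDeriv a ℓ k) s = genDirichletDeriv a ℓ (k + j) s := by
  induction j generalizing k s with
  | zero => simp
  | succ j ih =>
    rw [iteratedDeriv_succ']
    have hev : deriv (genDirichletDeriv a ℓ k) =ᶠ[𝓝 s] genDirichletDeriv a ℓ (k + 1) := by
      filter_upwards [(isOpen_re_gt σ₁).mem_nhds hs] with s' hs'
      exact (hasDerivAt_genDirichletDeriv ha hℓ h₁ k hs').deriv
    rw [hev.iteratedDeriv_eq j, ih (k + 1) hs]
    congr 1
    ring

/-- Iterated derivatives of `F` itself: `F^{(k)}(s) = ∑ᵢ aᵢ (−λᵢ)^k e^{−λᵢ s}` on `Re s > σ₁`.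
[cite: MontgomeryVaughan2007, §1.2 (1.8)] -/
theorem iteratedDeriv_genDirichlet (ha : ∀ i, 0 ≤ a i) (hℓ : ∀ i, 0 ≤ ℓ i) {σ₁ : ℝ}
    (h₁ : Summable fun i ↦ a i * Real.exp (-(ℓ i * σ₁))) (k : ℕ) {s : ℂ} (hs : σ₁ < s.re) :
    iteratedDeriv k (genDirichlet a ℓ) s = genDirichletDeriv a ℓ k s := by
  rw [← genDirichletDeriv_zero, iteratedDeriv_genDirichletDeriv ha hℓ h₁ k 0 hs, zero_add]


/-- `F` is holomorphic on `Re s > σ_c` as soon as the series converges at every real `σ > σ_c`.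
[cite: MontgomeryVaughan2007, §1.2 Thm. 1.7 (proof)] -/
theorem differentiableOn_genDirichlet_of_forall (ha : ∀ i, 0 ≤ a i) (hℓ : ∀ i, 0 ≤ ℓ i) {σc : ℝ}
    (hS : ∀ σ' : ℝ, σc < σ' → Summable fun i ↦ a i * Real.exp (-(ℓ i * σ'))) :
    DifferentiableOn ℂ (genDirichlet a ℓ) {s : ℂ | σc < s.re} := by
  intro s hs
  have h1 : σc < (σc + s.re) / 2 := by simp only [Set.mem_setOf_eq] at hs; linarith
  have h2 : (σc + s.re) / 2 < s.re := by simp only [Set.mem_setOf_eq] at hs; linarith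
  have := hasDerivAt_genDirichletDeriv ha hℓ (hS _ h1) 0 h2
  rw [genDirichletDeriv_zero] at this
  exact this.differentiableAt.differentiableWithinAt

/-! ### Landau's theorem, disc form -/

/-- **Landau's theorem, disc form** (MV Thm. 1.7 and its proof, for generalized Dirichlet series).
Let `aᵢ ≥ 0`, `λᵢ ≥ 0` with `∑ᵢ aᵢ e^{−λᵢ σ₁} < ∞`. If `F(s) = ∑ᵢ aᵢ e^{−λᵢ s}` agrees near the real
point `σ₂ > σ₁` with a function `Φ` holomorphic on the disc `|s − σ₂| < R`, then `∑ᵢ aᵢ e^{−λᵢ σ}`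
converges for every real `σ > σ₂ − R` ("Hence this last series converges at `s = −δ'/2`, contrary
to the assumption that `σ_c = 0`"). [cite: MontgomeryVaughan2007, §1.2 Thm. 1.7] -/
theorem summable_of_differentiableOn_ball (ha : ∀ i, 0 ≤ a i) (hℓ : ∀ i, 0 ≤ ℓ i)
    {σ₁ σ₂ R : ℝ} (h₁ : Summable fun i ↦ a i * Real.exp (-(ℓ i * σ₁))) (h12 : σ₁ < σ₂)
    {Φ : ℂ → ℂ} (hΦ : DifferentiableOn ℂ Φ (Metric.ball (σ₂ : ℂ) R))
    (hagree : Φ =ᶠ[𝓝 (σ₂ : ℂ)] genDirichlet a ℓ) {σ : ℝ} (hσ : σ₂ - R < σ) :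
    Summable fun i ↦ a i * Real.exp (-(ℓ i * σ)) := by
  by_cases hσ1 : σ₁ ≤ σ
  · exact summable_exp_of_le ha hℓ hσ1 h₁
  push Not at hσ1
  set r : ℝ := σ₂ - σ with hr
  have hr0 : 0 < r := by rw [hr]; linarith
  have hrR : r < R := by rw [hr]; linarith
  -- the Taylor series of `Φ` at `σ₂` converges at the real point `σ = σ₂ - r`
  have hz : ((σ : ℝ) : ℂ) ∈ Metric.ball (σ₂ : ℂ) R := by
    rw [Metric.mem_ball, dist_eq_norm, ← ofReal_sub, Complex.norm_real, Real.norm_eq_abs,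
      show σ - σ₂ = -r by rw [hr]; ring, abs_neg, abs_of_pos hr0]
    exact hrR
  have hT := Complex.hasSum_taylorSeries_on_ball hΦ hz
  -- its terms are the real numbers `c k = r^k/k! · B k`, `B k = ∑ᵢ aᵢ λᵢ^k e^{-λᵢ σ₂} ≥ 0`
  set B : ℕ → ℝ := fun k ↦ ∑' i, a i * (ℓ i ^ k * Real.exp (-(ℓ i * σ₂))) with hB
  set c : ℕ → ℝ := fun k ↦ r ^ k / k.factorial * B k with hc
  have hσ₂ : σ₁ < ((σ₂ : ℝ) : ℂ).re := by simpa using h12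
  have hBk : ∀ k : ℕ, genDirichletDeriv a ℓ k (σ₂ : ℂ) = (((-1 : ℝ) ^ k * B k : ℝ) : ℂ) :=
    fun k ↦ genDirichletDeriv_ofReal k σ₂
  have hterm : ∀ k : ℕ, ((k.factorial : ℂ)⁻¹ • (((σ : ℝ) : ℂ) - (σ₂ : ℂ)) ^ k •
      iteratedDeriv k Φ (σ₂ : ℂ)) = ((c k : ℝ) : ℂ) := by
    intro k
    rw [hagree.iteratedDeriv_eq k, iteratedDeriv_genDirichlet ha hℓ h₁ k hσ₂, hBk k]
    have h1 : (((σ : ℝ) : ℂ) - (σ₂ : ℂ)) = ((-r : ℝ) : ℂ) := by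
      rw [hr]
      push_cast
      ring
    rw [h1, smul_eq_mul, smul_eq_mul]
    simp only [hc]
    push_cast
    have h2 : ((-r : ℂ)) ^ k * (-1) ^ k = (r : ℂ) ^ k := by
      rw [← mul_pow]; congr 1; ring
    calc ((k.factorial : ℂ))⁻¹ * ((-(r : ℂ)) ^ k * ((-1) ^ k * (B k : ℂ)))
        = ((k.factorial : ℂ))⁻¹ * (((-(r : ℂ)) ^ k * (-1) ^ k) * (B k : ℂ)) := by ring
      _ = (r : ℂ) ^ k / (k.factorial : ℂ) * (B k : ℂ) := by rw [h2]; ring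
  have hsumC : Summable fun k : ℕ ↦ ((c k : ℝ) : ℂ) := by
    have := hT.summable
    simpa only [hterm] using this
  have hsum_c : Summable c := Complex.summable_ofReal.mp hsumC
  -- the double family `u (k, i) = aᵢ (r λᵢ)^k / k! · e^{-λᵢ σ₂} ≥ 0`
  set u : ℕ × ι → ℝ :=
    fun p ↦ a p.2 * ((r * ℓ p.2) ^ p.1 / p.1.factorial) * Real.exp (-(ℓ p.2 * σ₂)) with hu
  have hu0 : 0 ≤ u := fun p ↦ mul_nonneg (mul_nonneg (ha _)
    (div_nonneg (pow_nonneg (mul_nonneg hr0.le (hℓ _)) _) (Nat.cast_nonneg _))) (Real.exp_pos _).le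
  -- rows: for fixed `k` the sum over `i` is `c k`
  have hrow : ∀ k, HasSum (fun i ↦ u (k, i)) (c k) := by
    intro k
    have hs : Summable fun i ↦ a i * (ℓ i ^ k * Real.exp (-(ℓ i * σ₂))) := by
      refine (summable_norm_dirichletTerm ha hℓ h₁ k hσ₂).congr fun i ↦ ?_
      rw [norm_dirichletTerm, abs_of_nonneg (ha i), abs_of_nonneg (hℓ i), ofReal_re]
    have h3 : HasSum (fun i ↦ r ^ k / k.factorial * (a i * (ℓ i ^ k * Real.exp (-(ℓ i * σ₂)))))
        (c k) := hs.hasSum.mul_left _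
    have h4 : (fun i ↦ u (k, i)) =
        fun i ↦ r ^ k / k.factorial * (a i * (ℓ i ^ k * Real.exp (-(ℓ i * σ₂)))) := by
      funext i
      simp only [hu]
      rw [mul_pow]
      ring
    rw [h4]
    exact h3
  have hU : Summable u := by
    refine (summable_prod_of_nonneg hu0).2 ⟨fun k ↦ (hrow k).summable, ?_⟩
    exact hsum_c.congr fun k ↦ ((hrow k).tsum_eq).symm
  -- columns: for fixed `i` the sum over `k` is `aᵢ e^{r λᵢ} e^{-λᵢ σ₂} = aᵢ e^{-λᵢ σ}`
  have hcol : ∀ i, HasSum (fun k ↦ u (k, i)) (a i * Real.exp (-(ℓ i * σ))) := by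
    intro i
    have h1 : HasSum (fun k : ℕ ↦ (r * ℓ i) ^ k / k.factorial) (Real.exp (r * ℓ i)) := by
      rw [Real.exp_eq_exp_ℝ]
      exact NormedSpace.expSeries_div_hasSum_exp (r * ℓ i)
    have h2 := (h1.mul_left (a i)).mul_right (Real.exp (-(ℓ i * σ₂)))
    have h3 : a i * Real.exp (r * ℓ i) * Real.exp (-(ℓ i * σ₂)) = a i * Real.exp (-(ℓ i * σ)) := by
      rw [mul_assoc, ← Real.exp_add]
      congr 2
      rw [hr]
      ring
    rw [h3] at h2
    exact h2
  -- Tonelli: sum over `k` first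
  obtain ⟨A, hA⟩ := hU.prod_symm
  exact (hA.prod_fiberwise fun i ↦ hcol i).summable

/-! ### Landau's theorem, abscissa form -/

/-- **Landau's theorem, abscissa form** (MV Thm. 1.7: "the point `σ_c` is a singularity of the
function `α(s)`", for generalized Dirichlet series and in contrapositive form). Let `aᵢ ≥ 0`,
`λᵢ ≥ 0` with `∑ᵢ aᵢ e^{−λᵢ σ₁} < ∞`, and suppose `F(s) = ∑ᵢ aᵢ e^{−λᵢ s}` agrees on `Re s > σ₁` with
a function `Φ` holomorphic on `{Re s > σ₁} ∪ W₀`, where `W₀` is a convex open set containing the real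
segment `(a, σ₁ + 1]`. Then the series converges at every real `σ > a` (so the abscissa of
convergence is `≤ a`: no real point to the right of `a` at which `Φ` is holomorphic can be the
abscissa). Proof: the disc form at the infimum `σ_c` of the abscissae of convergence in `[a, σ₁]`,
holomorphy of `Φ` on a disc about `σ_c` and the identity theorem on
`{Re s > σ₁} ∪ (W₀ ∩ {Re s > σ_c})`. [cite: MontgomeryVaughan2007, §1.2 Thm. 1.7] -/
theorem summable_of_differentiableOn_union_convex (ha : ∀ i, 0 ≤ a i) (hℓ : ∀ i, 0 ≤ ℓ i)
    {σ₁ a₀ : ℝ} (h₁ : Summable fun i ↦ a i * Real.exp (-(ℓ i * σ₁))) (ha₀ : a₀ < σ₁)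
    {W₀ : Set ℂ} (hW₀o : IsOpen W₀) (hW₀c : Convex ℝ W₀)
    (hW₀r : ∀ σ : ℝ, a₀ < σ → σ ≤ σ₁ + 1 → (σ : ℂ) ∈ W₀)
    {Φ : ℂ → ℂ} (hΦ : DifferentiableOn ℂ Φ ({s : ℂ | σ₁ < s.re} ∪ W₀))
    (hagree : EqOn Φ (genDirichlet a ℓ) {s : ℂ | σ₁ < s.re}) {σ : ℝ} (hσ : a₀ < σ) :
    Summable fun i ↦ a i * Real.exp (-(ℓ i * σ)) := by
  -- the set of real abscissae of convergence in `[a₀, ∞)` and its infimum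
  set T : Set ℝ := {σ' : ℝ | a₀ ≤ σ' ∧ Summable fun i ↦ a i * Real.exp (-(ℓ i * σ'))} with hT
  have hT₁ : σ₁ ∈ T := ⟨ha₀.le, h₁⟩
  have hTne : T.Nonempty := ⟨σ₁, hT₁⟩
  have hTbdd : BddBelow T := ⟨a₀, fun σ' hσ' ↦ hσ'.1⟩
  set σc : ℝ := sInf T with hσc
  have hσc₁ : σc ≤ σ₁ := csInf_le hTbdd hT₁
  have haσc : a₀ ≤ σc := le_csInf hTne fun σ' hσ' ↦ hσ'.1
  -- everything to the right of `σc` converges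
  have hS : ∀ σ' : ℝ, σc < σ' → Summable fun i ↦ a i * Real.exp (-(ℓ i * σ')) := by
    intro σ' hσ'
    obtain ⟨σ'', hσ''T, hlt⟩ := exists_lt_of_csInf_lt hTne hσ'
    exact summable_exp_of_le ha hℓ hlt.le hσ''T.2
  -- it suffices to show `σc = a₀`
  suffices hca : σc ≤ a₀ by
    exact hS σ (lt_of_le_of_lt hca hσ)
  by_contra hca
  push Not at hca
  -- a disc about `σc` inside `W₀`, of radius `< σc - a₀`
  have hσcW : ((σc : ℝ) : ℂ) ∈ W₀ := hW₀r σc hca (by linarith)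
  obtain ⟨ε, hε, hball⟩ := Metric.isOpen_iff.1 hW₀o _ hσcW
  set r : ℝ := min (ε / 3) ((σc - a₀) / 2) with hr
  have hr0 : 0 < r := lt_min (by positivity) (by linarith)
  have hr3 : 3 * r ≤ ε := by
    have : r ≤ ε / 3 := min_le_left _ _
    linarith
  have hra : r < σc - a₀ := by
    have : r ≤ (σc - a₀) / 2 := min_le_right _ _
    linarith
  -- `F` is holomorphic on `Re s > σc` and agrees with `Φ` on the preconnected open set `V`
  have hF : DifferentiableOn ℂ (genDirichlet a ℓ) {s : ℂ | σc < s.re} :=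
    differentiableOn_genDirichlet_of_forall ha hℓ hS
  set V : Set ℂ := {s : ℂ | σ₁ < s.re} ∪ (W₀ ∩ {s : ℂ | σc < s.re}) with hV
  have hVo : IsOpen V := (isOpen_re_gt σ₁).union (hW₀o.inter (isOpen_re_gt σc))
  have hVpre : IsPreconnected V := by
    set p : ℂ := ((σ₁ + 1 / 2 : ℝ) : ℂ) with hp
    have hp1 : p ∈ {s : ℂ | σ₁ < s.re} := by simp [hp]
    have hp2 : p ∈ W₀ ∩ {s : ℂ | σc < s.re} := by
      refine ⟨hW₀r _ (by linarith) (by linarith), ?_⟩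
      simp only [hp, Set.mem_setOf_eq, ofReal_re]
      linarith
    exact IsPreconnected.union p hp1 hp2 (convex_halfSpace_re_gt σ₁).isPreconnected
      (hW₀c.inter (convex_halfSpace_re_gt σc)).isPreconnected
  have hΦV : AnalyticOnNhd ℂ Φ V := by
    refine (hΦ.mono ?_).analyticOnNhd hVo
    rintro s (hs | hs)
    · exact Or.inl hs
    · exact Or.inr hs.1
  have hFV : AnalyticOnNhd ℂ (genDirichlet a ℓ) V := by
    refine (hF.mono ?_).analyticOnNhd hVo
    rintro s (hs | hs)
    · simp only [Set.mem_setOf_eq] at hs ⊢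
      linarith
    · exact hs.2
  have hq : (((σ₁ + 1 : ℝ) : ℂ)) ∈ V := Or.inl (by simp)
  have hev : Φ =ᶠ[𝓝 (((σ₁ + 1 : ℝ) : ℂ))] genDirichlet a ℓ := by
    filter_upwards [(isOpen_re_gt σ₁).mem_nhds (show ((σ₁ + 1 : ℝ) : ℂ) ∈ {s : ℂ | σ₁ < s.re}
      by simp)] with s hs
    exact hagree hs
  have hEq : EqOn Φ (genDirichlet a ℓ) V :=
    hΦV.eqOn_of_preconnected_of_eventuallyEq hFV hVpre hq hev
  -- apply the disc form at `σ₂ = σc + r` with radius `2r`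
  have hballW : Metric.ball ((σc + r : ℝ) : ℂ) (2 * r) ⊆ W₀ := by
    refine (Metric.ball_subset_ball' ?_).trans hball
    rw [dist_eq_norm, ← ofReal_sub, Complex.norm_real, Real.norm_eq_abs,
      show σc + r - σc = r by ring, abs_of_pos hr0]
    linarith
  have hΦball : DifferentiableOn ℂ Φ (Metric.ball ((σc + r : ℝ) : ℂ) (2 * r)) :=
    hΦ.mono (hballW.trans Set.subset_union_right)
  have hσ₂V : ((σc + r : ℝ) : ℂ) ∈ V := by
    refine Or.inr ⟨hballW (Metric.mem_ball_self (by linarith)), ?_⟩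
    simp only [Set.mem_setOf_eq, ofReal_re]
    linarith
  have hagree₂ : Φ =ᶠ[𝓝 ((σc + r : ℝ) : ℂ)] genDirichlet a ℓ := by
    filter_upwards [hVo.mem_nhds hσ₂V] with s hs
    exact hEq hs
  have h₂ : Summable fun i ↦ a i * Real.exp (-(ℓ i * (σc + r / 2))) := hS _ (by linarith)
  have hstep := summable_of_differentiableOn_ball ha hℓ h₂
    (show σc + r / 2 < σc + r by linarith) hΦball hagree₂ (σ := σc - r / 2) (by linarith)
  -- so `σc - r/2 ∈ T`, contradicting `σc = inf T`
  have hmem : σc - r / 2 ∈ T := ⟨by linarith, hstep⟩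
  have := csInf_le hTbdd hmem
  linarith

/-! ### Landau's theorem, half-plane form -/

/-- **Landau's theorem, half-plane form** (the case `W₀ = {Re s > A}` of the abscissa form; the
form invoked by Jacquet–Shalika (1981), proof of Thm. (5.3): a Dirichlet series with non-negative
coefficients which "extends to a holomorphic function in `Re s > 1`" converges there). Let
`aᵢ ≥ 0`, `λᵢ ≥ 0`, `∑ᵢ aᵢ e^{−λᵢ σ₁} < ∞`; if `F(s) = ∑ᵢ aᵢ e^{−λᵢ s}` agrees on `Re s > σ₁` with a
function `Φ` holomorphic on the open half-plane `Re s > A`, then `∑ᵢ aᵢ e^{−λᵢ σ} < ∞` for every real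
`σ > A`. [cite: MontgomeryVaughan2007, §1.2 Thm. 1.7] -/
theorem summable_of_differentiableOn_halfPlane (ha : ∀ i, 0 ≤ a i) (hℓ : ∀ i, 0 ≤ ℓ i)
    {σ₁ A : ℝ} (h₁ : Summable fun i ↦ a i * Real.exp (-(ℓ i * σ₁)))
    {Φ : ℂ → ℂ} (hΦ : DifferentiableOn ℂ Φ {s : ℂ | A < s.re})
    (hagree : EqOn Φ (genDirichlet a ℓ) {s : ℂ | σ₁ < s.re}) {σ : ℝ} (hσ : A < σ) :
    Summable fun i ↦ a i * Real.exp (-(ℓ i * σ)) := by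
  by_cases hσ1 : σ₁ ≤ σ
  · exact summable_exp_of_le ha hℓ hσ1 h₁
  push Not at hσ1
  have hA1 : A < σ₁ := hσ.trans hσ1
  refine summable_of_differentiableOn_union_convex ha hℓ h₁ hA1 (isOpen_re_gt A)
    (convex_halfSpace_re_gt A) (fun σ' hσ' _ ↦ by simpa using hσ') (hΦ.mono ?_) hagree hσ
  rintro s (hs | hs)
  · simp only [Set.mem_setOf_eq] at hs ⊢
    linarith
  · exact hs

/-- Under the hypotheses of the half-plane form, `F` is holomorphic on `Re s > A` and `Φ = F`
there (identity theorem). [cite: MontgomeryVaughan2007, §1.2 Thm. 1.7] -/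
theorem eqOn_of_differentiableOn_halfPlane (ha : ∀ i, 0 ≤ a i) (hℓ : ∀ i, 0 ≤ ℓ i)
    {σ₁ A : ℝ} (h₁ : Summable fun i ↦ a i * Real.exp (-(ℓ i * σ₁))) (hA : A ≤ σ₁)
    {Φ : ℂ → ℂ} (hΦ : DifferentiableOn ℂ Φ {s : ℂ | A < s.re})
    (hagree : EqOn Φ (genDirichlet a ℓ) {s : ℂ | σ₁ < s.re}) :
    DifferentiableOn ℂ (genDirichlet a ℓ) {s : ℂ | A < s.re} ∧
      EqOn Φ (genDirichlet a ℓ) {s : ℂ | A < s.re} := by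
  have hS : ∀ σ' : ℝ, A < σ' → Summable fun i ↦ a i * Real.exp (-(ℓ i * σ')) :=
    fun σ' hσ' ↦ summable_of_differentiableOn_halfPlane ha hℓ h₁ hΦ hagree hσ'
  have hF : DifferentiableOn ℂ (genDirichlet a ℓ) {s : ℂ | A < s.re} :=
    differentiableOn_genDirichlet_of_forall ha hℓ hS
  refine ⟨hF, ?_⟩
  have hΦan : AnalyticOnNhd ℂ Φ {s : ℂ | A < s.re} := hΦ.analyticOnNhd (isOpen_re_gt A)
  have hFan : AnalyticOnNhd ℂ (genDirichlet a ℓ) {s : ℂ | A < s.re} :=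
    hF.analyticOnNhd (isOpen_re_gt A)
  have hq : (((σ₁ + 1 : ℝ) : ℂ)) ∈ {s : ℂ | A < s.re} := by
    simp only [Set.mem_setOf_eq, ofReal_re]
    linarith
  have hev : Φ =ᶠ[𝓝 (((σ₁ + 1 : ℝ) : ℂ))] genDirichlet a ℓ := by
    filter_upwards [(isOpen_re_gt σ₁).mem_nhds (show ((σ₁ + 1 : ℝ) : ℂ) ∈ {s : ℂ | σ₁ < s.re}
      by simp)] with s hs
    exact hagree hs
  exact hΦan.eqOn_of_preconnected_of_eventuallyEq hFan
    (convex_halfSpace_re_gt A).isPreconnected hq hev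


/-! ### Ordinary Dirichlet series (Mathlib's `LSeries`) -/

/-- Mathlib's `LSeries f` of a real sequence `f` is the generalized Dirichlet series with
frequencies `λₙ = log n` and coefficients `aₙ = f n` (`n ≥ 1`), `a₀ = 0` (MV, notes to §1.2:
"generalized Dirichlet series include … ordinary Dirichlet series (`λₙ = log n`)").
[cite: MontgomeryVaughan2007, §1.2 (notes)] -/
theorem LSeries_eq_genDirichlet (f : ℕ → ℝ) (s : ℂ) :
    LSeries (fun n ↦ (f n : ℂ)) s =
      genDirichlet (fun n : ℕ ↦ if n = 0 then 0 else f n) (fun n : ℕ ↦ Real.log n) s := by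
  unfold LSeries genDirichlet
  refine tsum_congr fun n ↦ ?_
  dsimp only
  rcases eq_or_ne n 0 with rfl | hn
  · simp
  · rw [LSeries.term_of_ne_zero hn, if_neg hn,
      Complex.cpow_def_of_ne_zero (Nat.cast_ne_zero.mpr hn), ← Complex.natCast_log,
      div_eq_mul_inv, ← Complex.exp_neg]
    congr 2
    ring

/-- The terms of `LSeries f` at a real point `σ` are the real numbers `aₙ e^{-σ log n}`
(`aₙ = f n` for `n ≥ 1`, `a₀ = 0`). [folklore] -/
theorem LSeries_term_ofReal (f : ℕ → ℝ) (σ : ℝ) (n : ℕ) :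
    LSeries.term (fun n ↦ (f n : ℂ)) σ n =
      (((if n = 0 then 0 else f n) * Real.exp (-(Real.log n * σ)) : ℝ) : ℂ) := by
  rcases eq_or_ne n 0 with rfl | hn
  · simp
  · rw [LSeries.term_of_ne_zero hn, if_neg hn,
      Complex.cpow_def_of_ne_zero (Nat.cast_ne_zero.mpr hn), ← Complex.natCast_log,
      div_eq_mul_inv, ← Complex.exp_neg]
    push_cast
    ring_nf

/-- `LSeriesSummable f σ` for real `f`, `σ` is summability of the real series `∑ aₙ e^{-σ log n}`.
[folklore] -/
theorem LSeriesSummable_ofReal_iff (f : ℕ → ℝ) (σ : ℝ) :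
    LSeriesSummable (fun n ↦ (f n : ℂ)) σ ↔
      Summable fun n : ℕ ↦ (if n = 0 then 0 else f n) * Real.exp (-(Real.log n * σ)) := by
  unfold LSeriesSummable
  rw [show LSeries.term (fun n ↦ (f n : ℂ)) σ = fun n ↦
      ((((if n = 0 then 0 else f n) * Real.exp (-(Real.log n * σ)) : ℝ)) : ℂ) from
    funext (LSeries_term_ofReal f σ), Complex.summable_ofReal]

/-! ### Landau's theorem, exponential form: continuation of `e^{F}` suffices -/

/-- A nowhere-vanishing holomorphic function on a disc has a holomorphic logarithm, in the form
`e^{g} = Φ` used below; a corollary of the tree's `Literature.Analysis.Complex.exists_log_on_ball`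
(`Literature/Analysis/Complex/LogDerivZeros.lean`: `Φ = Φ(c) e^{φ}`, `φ(c) = 0`, `φ' = Φ'/Φ`), with
`g = φ + log Φ(c)`. [folklore] -/
theorem exists_differentiableOn_cexp_eq {Φ : ℂ → ℂ} {c : ℂ} {r : ℝ}
    (hΦ : DifferentiableOn ℂ Φ (Metric.ball c r)) (h0 : ∀ z ∈ Metric.ball c r, Φ z ≠ 0) :
    ∃ g : ℂ → ℂ, DifferentiableOn ℂ g (Metric.ball c r) ∧
      EqOn (fun z ↦ Complex.exp (g z)) Φ (Metric.ball c r) := by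
  obtain ⟨φ, hφd, -, -, hφ⟩ := Literature.Analysis.Complex.exists_log_on_ball hΦ h0
  rcases le_or_gt r 0 with hr | hr
  · refine ⟨φ, hφd, fun z hz ↦ ?_⟩
    exact absurd (Metric.mem_ball.1 hz) (not_lt.2 (hr.trans dist_nonneg))
  have hc : Φ c ≠ 0 := h0 c (Metric.mem_ball_self hr)
  refine ⟨fun z ↦ φ z + Complex.log (Φ c), hφd.add (differentiableOn_const _), fun z hz ↦ ?_⟩
  simp only
  rw [Complex.exp_add, Complex.exp_log hc, hφ z hz, mul_comm]

/-- **Landau's theorem, exponential form** (folklore strengthening used for logarithms of Euler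
products, e.g. Jacquet–Shalika (1981), proof of Thm. (5.3), (5.3.3)–(5.3.4): the *logarithm*
`F(s) = ∑ᵢ aᵢ e^{−λᵢ s}` of an Euler product has non-negative coefficients, and it is `e^{F} = L`
which is continued). Let `aᵢ ≥ 0`, `λᵢ ≥ 0`, `∑ᵢ aᵢ e^{−λᵢ σ₁} < ∞`, and suppose `e^{F(s)}` agrees
on `Re s > σ₁` with a function `Φ` holomorphic on the open half-plane `Re s > A`. Then
`∑ᵢ aᵢ e^{−λᵢ σ} < ∞` for every real `σ > A`. (No non-vanishing hypothesis on `Φ` is needed: at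
the abscissa `σ_c > A` one would have `Φ(σ_c) = lim e^{F(σ)} ≥ 1`, so `Φ` has a holomorphic
logarithm on a disc about `σ_c`, which continues `F`; now apply the disc form.) [folklore] -/
theorem summable_of_differentiableOn_halfPlane_cexp (ha : ∀ i, 0 ≤ a i) (hℓ : ∀ i, 0 ≤ ℓ i)
    {σ₁ A : ℝ} (h₁ : Summable fun i ↦ a i * Real.exp (-(ℓ i * σ₁)))
    {Φ : ℂ → ℂ} (hΦ : DifferentiableOn ℂ Φ {s : ℂ | A < s.re})
    (hagree : EqOn Φ (fun s ↦ Complex.exp (genDirichlet a ℓ s)) {s : ℂ | σ₁ < s.re})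
    {σ : ℝ} (hσ : A < σ) :
    Summable fun i ↦ a i * Real.exp (-(ℓ i * σ)) := by
  by_cases hσ1 : σ₁ ≤ σ
  · exact summable_exp_of_le ha hℓ hσ1 h₁
  push Not at hσ1
  have hA1 : A < σ₁ := hσ.trans hσ1
  -- the set of real abscissae of convergence in `[A, ∞)` and its infimum
  set T : Set ℝ := {σ' : ℝ | A ≤ σ' ∧ Summable fun i ↦ a i * Real.exp (-(ℓ i * σ'))} with hT
  have hT₁ : σ₁ ∈ T := ⟨hA1.le, h₁⟩
  have hTne : T.Nonempty := ⟨σ₁, hT₁⟩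
  have hTbdd : BddBelow T := ⟨A, fun σ' hσ' ↦ hσ'.1⟩
  set σc : ℝ := sInf T with hσc
  have hσc₁ : σc ≤ σ₁ := csInf_le hTbdd hT₁
  have hAσc : A ≤ σc := le_csInf hTne fun σ' hσ' ↦ hσ'.1
  have hS : ∀ σ' : ℝ, σc < σ' → Summable fun i ↦ a i * Real.exp (-(ℓ i * σ')) := by
    intro σ' hσ'
    obtain ⟨σ'', hσ''T, hlt⟩ := exists_lt_of_csInf_lt hTne hσ'
    exact summable_exp_of_le ha hℓ hlt.le hσ''T.2
  suffices hca : σc ≤ A by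
    exact hS σ (lt_of_le_of_lt hca hσ)
  by_contra hca
  push Not at hca
  -- `F` is holomorphic on `Re s > σc` and `exp F = Φ` there (identity theorem)
  set F : ℂ → ℂ := genDirichlet a ℓ with hFdef
  have hF : DifferentiableOn ℂ F {s : ℂ | σc < s.re} :=
    differentiableOn_genDirichlet_of_forall ha hℓ hS
  have hO : IsOpen {s : ℂ | σc < s.re} := isOpen_re_gt σc
  have hexpF : DifferentiableOn ℂ (fun s ↦ Complex.exp (F s)) {s : ℂ | σc < s.re} := hF.cexp
  have hΦO : DifferentiableOn ℂ Φ {s : ℂ | σc < s.re} := hΦ.mono fun s hs ↦ by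
    simp only [Set.mem_setOf_eq] at hs ⊢
    linarith
  have hq : (((σ₁ + 1 : ℝ) : ℂ)) ∈ {s : ℂ | σc < s.re} := by
    simp only [Set.mem_setOf_eq, ofReal_re]
    linarith
  have hev : Φ =ᶠ[𝓝 (((σ₁ + 1 : ℝ) : ℂ))] fun s ↦ Complex.exp (F s) := by
    filter_upwards [(isOpen_re_gt σ₁).mem_nhds (show ((σ₁ + 1 : ℝ) : ℂ) ∈ {s : ℂ | σ₁ < s.re}
      by simp)] with s hs
    exact hagree hs
  have hEqO : EqOn Φ (fun s ↦ Complex.exp (F s)) {s : ℂ | σc < s.re} :=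
    (hΦO.analyticOnNhd hO).eqOn_of_preconnected_of_eventuallyEq (hexpF.analyticOnNhd hO)
      (convex_halfSpace_re_gt σc).isPreconnected hq hev
  -- `Φ(σc) ≠ 0`: `Φ(σ') = e^{F(σ')}` has real part `≥ 1` for real `σ' > σc`
  have hre : ∀ σ' : ℝ, σc < σ' → 1 ≤ (Φ σ').re := by
    intro σ' hσ'
    have h1 : Φ σ' = Complex.exp (F σ') := hEqO (by simpa using hσ')
    rw [h1, hFdef, genDirichlet_ofReal σ', ← Complex.ofReal_exp, Complex.ofReal_re]
    exact Real.one_le_exp (tsum_nonneg fun i ↦ mul_nonneg (ha i) (Real.exp_pos _).le)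
  have hΦc : ContinuousAt Φ (σc : ℂ) := by
    refine (hΦ.differentiableAt ((isOpen_re_gt A).mem_nhds ?_)).continuousAt
    simpa using hca
  have hΦσc : 1 ≤ (Φ (σc : ℂ)).re := by
    have ht : Tendsto (fun n : ℕ ↦ ((σc + 1 / (n + 1) : ℝ) : ℂ)) atTop (𝓝 (σc : ℂ)) := by
      have h1 : Tendsto (fun n : ℕ ↦ σc + 1 / ((n : ℝ) + 1)) atTop (𝓝 (σc + 0)) :=
        tendsto_const_nhds.add tendsto_one_div_add_atTop_nhds_zero_nat
      rw [add_zero] at h1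
      exact (Complex.continuous_ofReal.tendsto σc).comp h1
    have h2 : Tendsto (fun n : ℕ ↦ (Φ ((σc + 1 / (n + 1) : ℝ) : ℂ)).re) atTop
        (𝓝 (Φ (σc : ℂ)).re) :=
      (Complex.continuous_re.tendsto _).comp (hΦc.tendsto.comp ht)
    exact ge_of_tendsto' h2 fun n ↦ hre _ (by
      have : (0 : ℝ) < 1 / ((n : ℝ) + 1) := by positivity
      linarith)
  have hΦ0 : Φ (σc : ℂ) ≠ 0 := fun h ↦ by
    rw [h, Complex.zero_re] at hΦσc
    linarith
  -- a disc about `σc` inside `Re s > A` on which `Φ ≠ 0`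
  obtain ⟨ρ₀, hρ₀, hρ₀ne⟩ : ∃ ρ₀ > 0, ∀ z ∈ Metric.ball (σc : ℂ) ρ₀, Φ z ≠ 0 := by
    have hne : ∀ᶠ z in 𝓝 (σc : ℂ), Φ z ≠ 0 :=
      hΦc.eventually_ne hΦ0
    obtain ⟨ρ₀, hρ₀, hb⟩ := Metric.eventually_nhds_iff_ball.1 hne
    exact ⟨ρ₀, hρ₀, hb⟩
  set ρ : ℝ := min ρ₀ (σc - A) with hρ
  have hρ0 : 0 < ρ := lt_min hρ₀ (by linarith)
  have hρA : ρ ≤ σc - A := min_le_right _ _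
  have hballA : Metric.ball (σc : ℂ) ρ ⊆ {s : ℂ | A < s.re} := by
    intro z hz
    have h1 : |(z - σc).re| ≤ ‖z - (σc : ℂ)‖ := abs_re_le_norm _
    have h2 : ‖z - (σc : ℂ)‖ < ρ := by simpa [dist_eq_norm] using hz
    have h3 : |z.re - σc| < ρ := by simpa using h1.trans_lt h2
    have := (abs_lt.mp h3).1
    simp only [Set.mem_setOf_eq]
    linarith
  have hΦball : DifferentiableOn ℂ Φ (Metric.ball (σc : ℂ) ρ) := hΦ.mono hballA
  have h0ball : ∀ z ∈ Metric.ball (σc : ℂ) ρ, Φ z ≠ 0 := fun z hz ↦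
    hρ₀ne z (Metric.ball_subset_ball (min_le_left _ _) hz)
  -- a holomorphic logarithm `g` of `Φ` on the disc
  obtain ⟨g, hg, hgexp⟩ := exists_differentiableOn_cexp_eq hΦball h0ball
  -- on `U = disc ∩ {Re s > σc}`, `F` and `g` are two logarithms of `Φ`, so differ by a constant
  set U : Set ℂ := Metric.ball (σc : ℂ) ρ ∩ {s : ℂ | σc < s.re} with hU
  have hUo : IsOpen U := Metric.isOpen_ball.inter hO
  have hUpre : IsPreconnected U := ((convex_ball _ _).inter (convex_halfSpace_re_gt σc)).isPreconnected
  have hFU : DifferentiableOn ℂ F U := hF.mono Set.inter_subset_right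
  have hgU : DifferentiableOn ℂ g U := hg.mono Set.inter_subset_left
  have hderivF : ∀ z ∈ U, deriv F z = deriv Φ z / Φ z := by
    intro z hz
    have hzO : z ∈ {s : ℂ | σc < s.re} := hz.2
    have hFz : HasDerivAt F (deriv F z) z := (hF.differentiableAt (hO.mem_nhds hzO)).hasDerivAt
    have h1 : HasDerivAt (fun s ↦ Complex.exp (F s)) (Complex.exp (F z) * deriv F z) z := hFz.cexp
    have h2 : deriv Φ z = Complex.exp (F z) * deriv F z := by
      have hev : Φ =ᶠ[𝓝 z] fun s ↦ Complex.exp (F s) := by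
        filter_upwards [hO.mem_nhds hzO] with s hs
        exact hEqO hs
      rw [hev.deriv_eq, h1.deriv]
    have h3 : Φ z = Complex.exp (F z) := hEqO hzO
    rw [h2, h3]
    field_simp [Complex.exp_ne_zero (F z)]
  have hderivg : ∀ z ∈ U, deriv g z = deriv Φ z / Φ z := by
    intro z hz
    have hzB : z ∈ Metric.ball (σc : ℂ) ρ := hz.1
    have hgz : HasDerivAt g (deriv g z) z :=
      (hg.differentiableAt (Metric.isOpen_ball.mem_nhds hzB)).hasDerivAt
    have h1 : HasDerivAt (fun s ↦ Complex.exp (g s)) (Complex.exp (g z) * deriv g z) z := hgz.cexp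
    have h2 : deriv Φ z = Complex.exp (g z) * deriv g z := by
      have hev : Φ =ᶠ[𝓝 z] fun s ↦ Complex.exp (g s) := by
        filter_upwards [Metric.isOpen_ball.mem_nhds hzB] with s hs
        exact (hgexp hs).symm
      rw [hev.deriv_eq, h1.deriv]
    have h3 : Φ z = Complex.exp (g z) := (hgexp hzB).symm
    rw [h2, h3]
    field_simp [Complex.exp_ne_zero (g z)]
  obtain ⟨κ, hκ⟩ : ∃ κ, U.EqOn F (g · + κ) :=
    hUo.exists_eq_add_of_deriv_eq hUpre hFU hgU fun z hz ↦ by rw [hderivF z hz, hderivg z hz]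
  -- the disc form at `σ₂ = σc + ρ/4`, radius `3ρ/4`, with the continuation `g + κ` of `F`
  set Ψ : ℂ → ℂ := fun z ↦ g z + κ with hΨ
  have hball_sub : Metric.ball ((σc + ρ / 4 : ℝ) : ℂ) (3 * ρ / 4) ⊆ Metric.ball (σc : ℂ) ρ := by
    refine Metric.ball_subset_ball' ?_
    rw [dist_eq_norm, ← ofReal_sub, Complex.norm_real, Real.norm_eq_abs,
      show σc + ρ / 4 - σc = ρ / 4 by ring, abs_of_pos (by positivity)]
    linarith
  have hΨdiff : DifferentiableOn ℂ Ψ (Metric.ball ((σc + ρ / 4 : ℝ) : ℂ) (3 * ρ / 4)) :=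
    (hg.mono hball_sub).add (differentiableOn_const κ)
  have hσ₂U : ((σc + ρ / 4 : ℝ) : ℂ) ∈ U := by
    refine ⟨?_, ?_⟩
    · rw [Metric.mem_ball, dist_eq_norm, ← ofReal_sub, Complex.norm_real, Real.norm_eq_abs,
        show σc + ρ / 4 - σc = ρ / 4 by ring, abs_of_pos (by positivity)]
      linarith
    · simp only [Set.mem_setOf_eq, ofReal_re]
      linarith
  have hagree₂ : Ψ =ᶠ[𝓝 ((σc + ρ / 4 : ℝ) : ℂ)] genDirichlet a ℓ := by
    filter_upwards [hUo.mem_nhds hσ₂U] with s hs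
    exact (hκ hs).symm
  have h₂ : Summable fun i ↦ a i * Real.exp (-(ℓ i * (σc + ρ / 8))) := hS _ (by linarith)
  have hstep := summable_of_differentiableOn_ball ha hℓ h₂
    (show σc + ρ / 8 < σc + ρ / 4 by linarith) hΨdiff hagree₂ (σ := σc - ρ / 4) (by linarith)
  -- so `σc - ρ/4 ∈ T`, contradicting `σc = inf T`
  have hmem : σc - ρ / 4 ∈ T := ⟨by linarith, hstep⟩
  have := csInf_le hTbdd hmem
  linarith

end Landau

end Literature.NumberTheory.LFunctions

end
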